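import Mathlib

/-!
# Hodge locus census — invariants of the two explicit deformation families (engine B, pub-hlocus abs-2 gen 26)

certified instances and evidence bearing on the general Hodge conjecture; no claim.

Engine B's derivations of abs-1's THEOREMS T-1728@2 and T-0@3 (exact valuations of singular moduli at the
primes over 2, resp. 3) use EXPLICIT Weierstrass families over `W[[t]]` as universal deformations of the
supersingular curve and read the valuation of `j - 1728`, resp. `j`, off the invariants:
* at 2: `y² + t·x·y + y = x³`, with `c₄ = t⁴ - 24t`, `c₆ = -(t⁶ - 36t³ + 216)`, `Δ = t³ - 27`;
* at 3: `y² = x³ + t·x² - x`, with `c₄ = 16(t² + 3)`, `c₆ = -32t(2t² + 9)`, `Δ = 16(t² + 4)`.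
This file kernel-checks these hand computations for an arbitrary commutative ring and parameter, and
the two relations `j·Δ = c₄³`, `(j - 1728)·Δ = c₆²` that turn them into valuation formulas.
-/

namespace Summit.HodgeConjecture.HodgeConjecture.HodgeLocus.Census.DeformationFamilies

variable {R : Type*} [CommRing R]

/-- The family at 2: `y² + t x y + y = x³` (`a₁ = t`, `a₃ = 1`, other `aᵢ = 0`). -/
def fam2 (t : R) : WeierstrassCurve R := ⟨t, 0, 1, 0, 0⟩

/-- The family at 3: `y² = x³ + t x² - x` (`a₂ = t`, `a₄ = -1`, other `aᵢ = 0`). -/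
def fam3 (t : R) : WeierstrassCurve R := ⟨0, t, 0, -1, 0⟩

/-- `c₄` of the family at 2. -/
theorem fam2_c₄ (t : R) : (fam2 t).c₄ = t ^ 4 - 24 * t := by
  simp only [fam2, WeierstrassCurve.c₄, WeierstrassCurve.b₂, WeierstrassCurve.b₄]; ring

/-- `c₆` of the family at 2: `-(t⁶ - 36 t³ + 216)` (Weierstrass degree 6 modulo 2). -/
theorem fam2_c₆ (t : R) : (fam2 t).c₆ = -(t ^ 6 - 36 * t ^ 3 + 216) := by
  simp only [fam2, WeierstrassCurve.c₆, WeierstrassCurve.b₂, WeierstrassCurve.b₄, WeierstrassCurve.b₆]; ring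

/-- `Δ` of the family at 2: `t³ - 27` (a unit of `W(𝔽̄₂)[[t]]`). -/
theorem fam2_Δ (t : R) : (fam2 t).Δ = t ^ 3 - 27 := by
  simp only [fam2, WeierstrassCurve.Δ, WeierstrassCurve.b₂, WeierstrassCurve.b₄, WeierstrassCurve.b₆,
    WeierstrassCurve.b₈]; ring

/-- `c₄` of the family at 3: `16 (t² + 3)` (so `div c₄ = V(t² + 3)` on `Spf W(𝔽̄₃)[[t]]`). -/
theorem fam3_c₄ (t : R) : (fam3 t).c₄ = 16 * (t ^ 2 + 3) := by
  simp only [fam3, WeierstrassCurve.c₄, WeierstrassCurve.b₂, WeierstrassCurve.b₄]; ring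

/-- `c₆` of the family at 3. -/
theorem fam3_c₆ (t : R) : (fam3 t).c₆ = -(32 * t * (2 * t ^ 2 + 9)) := by
  simp only [fam3, WeierstrassCurve.c₆, WeierstrassCurve.b₂, WeierstrassCurve.b₄, WeierstrassCurve.b₆]; ring

/-- `Δ` of the family at 3: `16 (t² + 4)` (a unit of `W(𝔽̄₃)[[t]]`). -/
theorem fam3_Δ (t : R) : (fam3 t).Δ = 16 * (t ^ 2 + 4) := by
  simp only [fam3, WeierstrassCurve.Δ, WeierstrassCurve.b₂, WeierstrassCurve.b₄, WeierstrassCurve.b₆,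
    WeierstrassCurve.b₈]; ring

/-- The discriminant relation for the family at 2, as explicit polynomials. -/
theorem fam2_relation (t : R) :
    (t ^ 4 - 24 * t) ^ 3 - (-(t ^ 6 - 36 * t ^ 3 + 216)) ^ 2 = 1728 * (t ^ 3 - 27) := by ring

/-- The discriminant relation for the family at 3, as explicit polynomials. -/
theorem fam3_relation (t : R) :
    (16 * (t ^ 2 + 3)) ^ 3 - (-(32 * t * (2 * t ^ 2 + 9))) ^ 2 = 1728 * (16 * (t ^ 2 + 4)) := by ring

/-- Over a field, at a parameter where `Δ ≠ 0`: `j · Δ = c₄³` and `(j - 1728) · Δ = c₆²` for ANY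
Weierstrass curve — the form in which the invariants become valuation formulas
(`v(j) = 3 v(c₄) - v(Δ)`, `v(j - 1728) = 2 v(c₆) - v(Δ)`). -/
theorem j_mul_Δ {K : Type*} [Field K] (W : WeierstrassCurve K) (hΔ : W.Δ ≠ 0) :
    (W.c₄ ^ 3 / W.Δ) * W.Δ = W.c₄ ^ 3 ∧ (W.c₄ ^ 3 / W.Δ - 1728) * W.Δ = W.c₆ ^ 2 := by
  refine ⟨div_mul_cancel₀ _ hΔ, ?_⟩
  have h := W.c_relation
  rw [sub_mul, div_mul_cancel₀ _ hΔ]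
  linear_combination (-1 : K) * h

/-- The family at 3, specialised: at `t² = -3` the curve has `c₄ = 0` (hence `j = 0`): the canonical
divisor of `ℤ[ζ₃]` is `V(t² + 3)`. -/
theorem fam3_c₄_eq_zero_of_sq {t : R} (ht : t ^ 2 = -3) : (fam3 t).c₄ = 0 := by
  rw [fam3_c₄, ht]; ring

/-- The family at 2, specialised: `c₆ (fam2 t) = -(u² - 36 u + 216)` with `u = t³`, and the roots of
`u² - 36u + 216` are `u = 18 ± 6√3`; equivalently `c₆ = -((t³ - 18)² - 108)`. -/
theorem fam2_c₆_completed_square (t : R) : (fam2 t).c₆ = -((t ^ 3 - 18) ^ 2 - 108) := by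
  rw [fam2_c₆]; ring

/-- Numerical sanity (ℤ): at `t = 3` the family at 2 is singular (`Δ = 0`), at `t = 0` it is
`y² + y = x³` with `c₄ = 0`, `c₆ = -216`, `Δ = -27` (`j = 0`); the family at 3 at `t = 0` is
`y² = x³ - x` with `c₄ = 48`, `c₆ = 0`, `Δ = 64` (`j = 1728`). -/
example : (fam2 (3 : ℤ)).Δ = 0 ∧ (fam2 (0 : ℤ)).c₄ = 0 ∧ (fam2 (0 : ℤ)).c₆ = -216 ∧ (fam2 (0 : ℤ)).Δ = -27
    ∧ (fam3 (0 : ℤ)).c₄ = 48 ∧ (fam3 (0 : ℤ)).c₆ = 0 ∧ (fam3 (0 : ℤ)).Δ = 64 := by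
  refine ⟨?_, ?_, ?_, ?_, ?_, ?_, ?_⟩ <;>
  simp [fam2_Δ, fam2_c₄, fam2_c₆, fam3_c₄, fam3_c₆, fam3_Δ]

end Summit.HodgeConjecture.HodgeConjecture.HodgeLocus.Census.DeformationFamilies
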